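import Literature.Geometry.DiscreteGeometry.KissingAngleBounds
import HarnessLib

/-!
# Decidable rational brackets for `arccos` (the numeric kernel of the kissing linear programs)

Topic `Literature/Geometry/DiscreteGeometry`; provefact brick for `Hales2012_contactGraphTame`
(`TameContactGraphs.lean`).  The finite classification behind Hales's Theorem 3 / Lemma 8 is a
search over labelled fan triangulations in which every pruning step compares sums of triangle
ANGLES — values of `arccos` at algebraic functions of the side cosines — with `2π`
(`KissingFanTriangleSets.lean`: the node equation `sum_triAngleAt`).  To run such comparisons
in the kernel (`decide` / `native_decide`) one needs Boolean tests on RATIONALS that certify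
inequalities `θ ≤ arccos q`, `arccos q ≤ θ`, `θ ≤ arccos (√r)`, `arccos (√r) ≤ θ`.  This file
provides them, from the polynomial brackets `cos_lower_quarter` / `cos_upper_quarter` of
`KissingAngleBounds.lean` (valid on `[0, 2.6]`):

* `cosLoQ`, `cosHiQ : ℚ → ℚ` — the two polynomials, with `cosLoQ_le_cos`, `cos_le_cosHiQ`;
* `leArccosB θ q` (certifies `θ ≤ arccos q`), `arccosLeB q θ` (certifies `arccos q ≤ θ`; also
  accepts any `θ ≥ 3.1416 ≥ π`), `leArccosSqrtB θ r` (`θ ≤ arccos (√r)`), `arccosSqrtLeB r θ`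
  (`arccos (√r) ≤ θ`), each with its soundness theorem (`le_arccos_of_leArccosB`, …);
* the **ladder**: `ladderDown δ N q` / `ladderUp δ N q` — a multiple `k δ` of the step `δ` that
  is certified `≤ arccos q` / `≥ arccos q` (binary search over `k ≤ N`; soundness needs no
  monotonicity: `ladderDown_mul_le_arccos`; `arccos_le_ladderUp_mul` under `arccosLeB q (N δ)`), and the
  `√`-variants `ladderSqrtDown`, `ladderSqrtUp`.

Everything is PROVED; no named facts; all definitions are computable.

## References
* T. C. Hales, arXiv:1209.6043 (2012), proof of Lemma 9 (linear programs in the angles).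
  [`Hales2012`]
* R. E. Moore, *Interval Analysis* (1966), §3 (inclusion property). [`Moore1966`]
-/

namespace Literature.Geometry.DiscreteGeometry

open Real

namespace KissingLP

/-! ### Part A. The two polynomials over `ℚ` -/

/-- The polynomial lower bracket of `cos` on `[0, 2.6]` (`cos_lower_quarter`), over `ℚ`.
[folklore] -/
def cosLoQ (t : ℚ) : ℚ :=
  2 * (1 - 2 * (t / 4 - (t / 4) ^ 3 / 6 + (t / 4) ^ 5 / 100) ^ 2) ^ 2 - 1

/-- The polynomial upper bracket of `cos` on `[0, 2.6]` (`cos_upper_quarter`), over `ℚ`.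
[folklore] -/
def cosHiQ (t : ℚ) : ℚ :=
  2 * (1 - 2 * (t / 4 - (t / 4) ^ 3 / 6) ^ 2) ^ 2 - 1

/-- `cosLoQ t ≤ cos t` for `0 ≤ t ≤ 13/5`. [folklore] -/
theorem cosLoQ_le_cos {t : ℚ} (h0 : 0 ≤ t) (h1 : t ≤ 13 / 5) : ((cosLoQ t : ℚ) : ℝ) ≤ cos t := by
  have h0' : (0 : ℝ) ≤ t := by exact_mod_cast h0
  have h1' : (t : ℝ) ≤ 2.6 := by
    have : ((t : ℚ) : ℝ) ≤ ((13 / 5 : ℚ) : ℝ) := by exact_mod_cast h1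
    rw [show ((13 / 5 : ℚ) : ℝ) = 2.6 by norm_num] at this
    exact this
  have h := cos_lower_quarter h0' h1'
  unfold cosLoQ
  push_cast
  exact h

/-- `cos t ≤ cosHiQ t` for `0 ≤ t ≤ 13/5`. [folklore] -/
theorem cos_le_cosHiQ {t : ℚ} (h0 : 0 ≤ t) (h1 : t ≤ 13 / 5) : cos t ≤ ((cosHiQ t : ℚ) : ℝ) := by
  have h0' : (0 : ℝ) ≤ t := by exact_mod_cast h0
  have h1' : (t : ℝ) ≤ 2.6 := by
    have : ((t : ℚ) : ℝ) ≤ ((13 / 5 : ℚ) : ℝ) := by exact_mod_cast h1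
    rw [show ((13 / 5 : ℚ) : ℝ) = 2.6 by norm_num] at this
    exact this
  have h := cos_upper_quarter h0' h1'
  unfold cosHiQ
  push_cast
  exact h

/-- `13/5 < π`. [folklore] -/
theorem thirteen_fifths_lt_pi : ((13 / 5 : ℚ) : ℝ) < π := by
  have := pi_gt_three
  push_cast
  linarith

/-! ### Part B. The four certified comparisons -/

/-- **Certifies `θ ≤ arccos q`**: `0 ≤ θ ≤ 13/5` and `q ≤ cosLoQ θ`. [folklore] -/
def leArccosB (θ q : ℚ) : Bool :=
  decide (0 ≤ θ) && decide (θ ≤ 13 / 5) && decide (q ≤ cosLoQ θ)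

/-- Soundness of `leArccosB`. [folklore] -/
theorem le_arccos_of_leArccosB {θ q : ℚ} (h : leArccosB θ q = true) : (θ : ℝ) ≤ arccos q := by
  unfold leArccosB at h
  simp only [Bool.and_eq_true, decide_eq_true_eq] at h
  obtain ⟨⟨h0, h1⟩, hq⟩ := h
  have hθπ : (θ : ℝ) ≤ π :=
    ((Rat.cast_le.2 h1).trans thirteen_fifths_lt_pi.le)
  have h0' : (0 : ℝ) ≤ θ := by exact_mod_cast h0
  have hcos : (q : ℝ) ≤ cos θ := ((Rat.cast_le.2 hq).trans (cosLoQ_le_cos h0 h1))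
  calc (θ : ℝ) = arccos (cos θ) := (arccos_cos h0' hθπ).symm
    _ ≤ arccos q := arccos_le_arccos hcos

/-- **Certifies `arccos q ≤ θ`**: `0 ≤ θ ≤ 13/5` and `cosHiQ θ ≤ q`, or `θ ≥ 3.1416 (≥ π)`.
[folklore] -/
def arccosLeB (q θ : ℚ) : Bool :=
  (decide (0 ≤ θ) && decide (θ ≤ 13 / 5) && decide (cosHiQ θ ≤ q)) || decide (3.1416 ≤ θ)

/-- Soundness of `arccosLeB`. [folklore] -/
theorem arccos_le_of_arccosLeB {q θ : ℚ} (h : arccosLeB q θ = true) : arccos q ≤ (θ : ℝ) := by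
  unfold arccosLeB at h
  simp only [Bool.or_eq_true, Bool.and_eq_true, decide_eq_true_eq] at h
  rcases h with ⟨⟨h0, h1⟩, hq⟩ | hpi
  · have hθπ : (θ : ℝ) ≤ π := ((Rat.cast_le.2 h1).trans thirteen_fifths_lt_pi.le)
    have h0' : (0 : ℝ) ≤ θ := by exact_mod_cast h0
    have hcos : cos θ ≤ (q : ℝ) := (cos_le_cosHiQ h0 h1).trans (Rat.cast_le.2 hq)
    calc arccos q ≤ arccos (cos θ) := arccos_le_arccos hcos
      _ = θ := arccos_cos h0' hθπ
  · have hpi' : π ≤ (θ : ℝ) := by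
      have h1 : ((3.1416 : ℚ) : ℝ) ≤ θ := by exact_mod_cast hpi
      have h2 := pi_lt_d4
      have h3 : ((3.1416 : ℚ) : ℝ) = 3.1416 := by norm_num
      linarith
    exact (arccos_le_pi _).trans hpi'

/-- **Certifies `θ ≤ arccos (√r)`**: `0 ≤ θ ≤ 13/5`, `0 ≤ cosLoQ θ` and `r ≤ (cosLoQ θ)²`.
[folklore] -/
def leArccosSqrtB (θ r : ℚ) : Bool :=
  decide (0 ≤ θ) && decide (θ ≤ 13 / 5) && decide (0 ≤ cosLoQ θ) && decide (r ≤ cosLoQ θ ^ 2)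

/-- Soundness of `leArccosSqrtB`. [folklore] -/
theorem le_arccos_sqrt_of_leArccosSqrtB {θ r : ℚ} (h : leArccosSqrtB θ r = true) :
    (θ : ℝ) ≤ arccos (Real.sqrt r) := by
  unfold leArccosSqrtB at h
  simp only [Bool.and_eq_true, decide_eq_true_eq] at h
  obtain ⟨⟨⟨h0, h1⟩, hc0⟩, hr⟩ := h
  have hθπ : (θ : ℝ) ≤ π := ((Rat.cast_le.2 h1).trans thirteen_fifths_lt_pi.le)
  have h0' : (0 : ℝ) ≤ θ := by exact_mod_cast h0
  have hc0' : (0 : ℝ) ≤ (cosLoQ θ : ℚ) := by exact_mod_cast hc0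
  have hsqrt : Real.sqrt r ≤ ((cosLoQ θ : ℚ) : ℝ) := by
    rw [← Real.sqrt_sq hc0']
    apply Real.sqrt_le_sqrt
    exact_mod_cast hr
  have hcos : Real.sqrt r ≤ cos θ := hsqrt.trans (cosLoQ_le_cos h0 h1)
  calc (θ : ℝ) = arccos (cos θ) := (arccos_cos h0' hθπ).symm
    _ ≤ arccos (Real.sqrt r) := arccos_le_arccos hcos

/-- **Certifies `arccos (√r) ≤ θ`**: `0 ≤ θ ≤ 13/5` and (`cosHiQ θ ≤ 0`, or `0 ≤ r` and
`(cosHiQ θ)² ≤ r`), or `θ ≥ 3.1416`. [folklore] -/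
def arccosSqrtLeB (r θ : ℚ) : Bool :=
  (decide (0 ≤ θ) && decide (θ ≤ 13 / 5) &&
    (decide (cosHiQ θ ≤ 0) || (decide (0 ≤ r) && decide (cosHiQ θ ^ 2 ≤ r)))) ||
  decide (3.1416 ≤ θ)

/-- Soundness of `arccosSqrtLeB`. [folklore] -/
theorem arccos_sqrt_le_of_arccosSqrtLeB {r θ : ℚ} (h : arccosSqrtLeB r θ = true) :
    arccos (Real.sqrt r) ≤ (θ : ℝ) := by
  unfold arccosSqrtLeB at h
  simp only [Bool.or_eq_true, Bool.and_eq_true, decide_eq_true_eq] at h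
  rcases h with ⟨⟨h0, h1⟩, hq⟩ | hpi
  · have hθπ : (θ : ℝ) ≤ π := ((Rat.cast_le.2 h1).trans thirteen_fifths_lt_pi.le)
    have h0' : (0 : ℝ) ≤ θ := by exact_mod_cast h0
    have hcos : cos θ ≤ Real.sqrt r := by
      refine (cos_le_cosHiQ h0 h1).trans ?_
      rcases le_or_gt ((cosHiQ θ : ℚ) : ℝ) 0 with hc | hc
      · exact hc.trans (Real.sqrt_nonneg _)
      · rcases hq with hle | ⟨_, hsq⟩
        · exact absurd (Rat.cast_nonpos.2 hle) (not_le.2 hc)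
        · calc ((cosHiQ θ : ℚ) : ℝ) = Real.sqrt (((cosHiQ θ : ℚ) : ℝ) ^ 2) :=
                (Real.sqrt_sq hc.le).symm
            _ ≤ Real.sqrt r := Real.sqrt_le_sqrt (by exact_mod_cast hsq)
    calc arccos (Real.sqrt r) ≤ arccos (cos θ) := arccos_le_arccos hcos
      _ = θ := arccos_cos h0' hθπ
  · have hpi' : π ≤ (θ : ℝ) := by
      have h1 : ((3.1416 : ℚ) : ℝ) ≤ θ := by exact_mod_cast hpi
      have h2 := pi_lt_d4
      have h3 : ((3.1416 : ℚ) : ℝ) = 3.1416 := by norm_num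
      linarith
    exact (arccos_le_pi _).trans hpi'

/-! ### Part C. The ladder: certified multiples of a step `δ` below / above `arccos` -/

/-- Binary search for a large `k < hi` with `P k` (assuming, for efficiency only, that `P` is
downward closed); returns `lo` when the bracket closes. [folklore] -/
def bsearchMax (P : ℕ → Bool) : ℕ → ℕ → ℕ → ℕ
  | 0, lo, _ => lo
  | fuel + 1, lo, hi =>
    if hi ≤ lo + 1 then lo
    else
      let mid := (lo + hi) / 2
      if P mid then bsearchMax P fuel mid hi else bsearchMax P fuel lo mid

/-- Binary search for a small `k ≤ hi` with `P k` (assuming, for efficiency only, that `P` is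
upward closed); returns `hi` when the bracket closes. [folklore] -/
def bsearchMin (P : ℕ → Bool) : ℕ → ℕ → ℕ → ℕ
  | 0, _, hi => hi
  | fuel + 1, lo, hi =>
    if hi ≤ lo + 1 then hi
    else
      let mid := (lo + hi) / 2
      if P mid then bsearchMin P fuel lo mid else bsearchMin P fuel mid hi

/-- **`ladderDown δ N q`**: a `k ≤ N` with `k δ ≤ arccos q` certified by `leArccosB` (`0` if the
search fails). [folklore] -/
def ladderDown (δ : ℚ) (N : ℕ) (q : ℚ) : ℕ :=
  let k := bsearchMax (fun k => leArccosB (k * δ) q) (N + 1) 0 (N + 1)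
  if leArccosB (k * δ) q then k else 0

/-- Soundness of `ladderDown`. [folklore] -/
theorem ladderDown_mul_le_arccos (δ : ℚ) (N : ℕ) (q : ℚ) :
    ((ladderDown δ N q : ℕ) : ℝ) * δ ≤ arccos q := by
  unfold ladderDown
  simp only
  split_ifs with h
  · have := le_arccos_of_leArccosB h
    push_cast at this
    exact this
  · simp only [Nat.cast_zero, zero_mul]
    exact arccos_nonneg _

/-- **`ladderUp δ N q`**: a `k ≤ N` with `arccos q ≤ k δ` certified by `arccosLeB` (`N` if the
search fails; sound when `arccosLeB q (N δ)` holds, e.g. `N δ ≥ 3.1416`). [folklore] -/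
def ladderUp (δ : ℚ) (N : ℕ) (q : ℚ) : ℕ :=
  let k := bsearchMin (fun k => arccosLeB q (k * δ)) (N + 1) 0 N
  if arccosLeB q (k * δ) then k else N

/-- Soundness of `ladderUp`. [folklore] -/
theorem arccos_le_ladderUp_mul {δ : ℚ} {N : ℕ} {q : ℚ} (hN : arccosLeB q (N * δ) = true) :
    arccos q ≤ ((ladderUp δ N q : ℕ) : ℝ) * δ := by
  unfold ladderUp
  simp only
  split_ifs with h
  · have := arccos_le_of_arccosLeB h
    push_cast at this
    exact this
  · have := arccos_le_of_arccosLeB hN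
    push_cast at this
    exact this

/-- **`ladderSqrtDown δ N r`**: a `k ≤ N` with `k δ ≤ arccos (√r)` certified by `leArccosSqrtB`.
[folklore] -/
def ladderSqrtDown (δ : ℚ) (N : ℕ) (r : ℚ) : ℕ :=
  let k := bsearchMax (fun k => leArccosSqrtB (k * δ) r) (N + 1) 0 (N + 1)
  if leArccosSqrtB (k * δ) r then k else 0

/-- Soundness of `ladderSqrtDown`. [folklore] -/
theorem ladderSqrtDown_mul_le_arccos (δ : ℚ) (N : ℕ) (r : ℚ) :
    ((ladderSqrtDown δ N r : ℕ) : ℝ) * δ ≤ arccos (Real.sqrt r) := by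
  unfold ladderSqrtDown
  simp only
  split_ifs with h
  · have := le_arccos_sqrt_of_leArccosSqrtB h
    push_cast at this
    exact this
  · simp only [Nat.cast_zero, zero_mul]
    exact arccos_nonneg _

/-- **`ladderSqrtUp δ N r`**: a `k ≤ N` with `arccos (√r) ≤ k δ` certified by `arccosSqrtLeB`
(`N` if the search fails; sound when `arccosSqrtLeB r (N δ)` holds). [folklore] -/
def ladderSqrtUp (δ : ℚ) (N : ℕ) (r : ℚ) : ℕ :=
  let k := bsearchMin (fun k => arccosSqrtLeB r (k * δ)) (N + 1) 0 N
  if arccosSqrtLeB r (k * δ) then k else N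

/-- Soundness of `ladderSqrtUp`. [folklore] -/
theorem arccos_le_ladderSqrtUp_mul {δ : ℚ} {N : ℕ} {r : ℚ} (hN : arccosSqrtLeB r (N * δ) = true) :
    arccos (Real.sqrt r) ≤ ((ladderSqrtUp δ N r : ℕ) : ℝ) * δ := by
  unfold ladderSqrtUp
  simp only
  split_ifs with h
  · have := arccos_sqrt_le_of_arccosSqrtLeB h
    push_cast at this
    exact this
  · have := arccos_sqrt_le_of_arccosSqrtLeB hN
    push_cast at this
    exact this

/- Smoke test (compiled evaluation): with step `1/256` and `N = 805` (`805/256 > 3.1416`),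
`ladderDown (1/256) 805 (1/3) = 315` and `ladderUp (1/256) 805 (1/3) = 316`, i.e.
`α₃ = arccos (1/3) ≈ 1.23096 ∈ [315/256, 316/256] ≈ [1.2305, 1.2344]`. -/


end KissingLP

end Literature.Geometry.DiscreteGeometry
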